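import Summits.BirchSwinnertonDyer.BirchSwinnertonDyer.Theorems.Rank2ShaTierKit
import HarnessLib

/-!
# BirchSwinnertonDyer — rank-2 `Ш[p^∞]` cell: the BOOKED row statements of the census tiers
# (one named theorem per census row; curve side entirely in the kernel, `2 ≤ rank` instantiated)

HONEST FRAMING (cell `b2b-bsdr2sha`, run/shared/lean/b2b/bsd-rank2-sha/): per-pair certified
theorems «cited hypotheses ∧ certified computation ⇒ `Ш(E/ℚ)[p^∞]` finite of order `p^k`» for
rank-2 curves at good ordinary primes; NO claim on BSD in rank `≥ 2`, no class-level theorem, every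
published input is a NAMED HYPOTHESIS of the tree (nothing is asserted or minted here).

Companion of `Rank2ShaTierKit.lean` (`ShaRow`, kernel tests `check` / `checkSU` / `checkK`, row theorems
`su`, `kato`, `kato_eq_one`). This file fixes, per frame, the STATEMENT a booked census row carries and the
lemma that proves it from (i) the row's kernel test, (ii) the tree's kernel rank certificate
`2 ≤ rank_ℤ E(ℚ)` for the same integral model (observatory `KernelCerts*.two_le_rank`), and — for the
«`Ш = 0`» form — (iii) the kernel evaluation `R.k ≤ 0` of the census exponent. A machine-written tier
file `Rank2ShaTier<prefix>NNN.lean` is then nothing but named KERNEL-CERTIFICATE theorems, one per census row,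
`theorem sha_<label>_<p> : (<row> : ShaRow).checkK = true ∧ (<row> : ShaRow).k ≤ 0 ∧ 2 ≤ rank_ℤ E(ℚ) :=
⟨by decide +kernel, by decide +kernel, KernelCerts….C<label>.two_le_rank⟩`, and the READER theorems of this
file (`ShaRow.booked_katoOne` etc.) turn such a certificate into the row's `Ш`-statement, whose ONLY binders are
the census's named facts and engine data:

* `hS : Schneider1985_order_charGenerator_odd` (Perrin-Riou–Schneider, BMS Thm. 1.7 = SW13 Thm. 6.1);
* `hK : kato_divisibility` for every cyclotomic datum (Kato Thm. 17.4) — or `hSU :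
  skinner_urban_main_conjecture` (Skinner–Urban Thm. 3.6.9) in the su-exact frame;
* `hf : IsNewformOf E f` (modularity: the newform of `E`);
* the L-datum `hLp : [T²] L_p(E,T) ≠ 0`, `hcoeff : ord_p [T²] L_p = R.a` (two engines, SW13 Prop. 3.5);
* the height datum: THE canonical `Dh` with `hreg : ord_p Reg_p(E) = R.b` (two engines, SW13 (4.1)).

Readers (theorems only; the instances `Fact p.Prime`, `IsElliptic`, `IsGloballyMinimal` are built from the
certificate inside the statement): `booked_katoOne` / `booked_katoOneSU` («`Ш(E/ℚ)[p^∞] = 0`», V-BOUND 0, image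
by Serre witness / by Irr+Ram), `booked_katoLe` / `booked_katoLeSU` (`ord_p #Ш ≤ R.k`, V-BOUND b), `booked_su`
(`#Ш = p^{R.k}`, V-EXACT), `booked_finite` (V-FINITE: `rank = 2`, `ord_T L_p = 2`, `Ш[p^∞]` finite, Schneider
non-degeneracy; no image hypothesis, no `a`, `b`). No definitions, no new axioms, no `sorry`.
References: K. Kato, Astérisque 295 (2004), Thm. 17.4 [Kato2004Asterisque]; C. Skinner, E. Urban,
Invent. Math. 195 (2014), Thm. 3.6.9 [SkinnerUrban2014]; J. Balakrishnan, J. S. Müller, W. Stein, Math.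
Comp. 85 (2016), Thm. 1.7 [BalakrishnanMullerStein2015]; W. Stein, C. Wuthrich, Math. Comp. 82 (2013),
Alg. 11.1, Prop. 11.2 [SteinWuthrich2013]; J.-P. Serre, Invent. Math. 15 (1972), Prop. 19 [Serre1972].
-/

set_option autoImplicit false

-- single-conjunct summit: `Summit.BirchSwinnertonDyer.BirchSwinnertonDyer.…` repeats the name by design
set_option linter.dupNamespace false

noncomputable section

open scoped Classical MatrixGroups ModularForm

open CongruenceSubgroup WeierstrassCurve Literature.NumberTheory.EllipticCurves
  Literature.NumberTheory.EllipticCurves.ModularForms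
  Literature.NumberTheory.EllipticCurves.Rank1Residual
  Summit.BirchSwinnertonDyer.BirchSwinnertonDyer.Rank2Observatory

namespace Summit.BirchSwinnertonDyer.BirchSwinnertonDyer.Rank2Sha

namespace ShaRow

variable {R : ShaRow}

/-! ## Readers: from a row's kernel certificate to its `Ш`-statement -/

/-- **READER, V-BOUND 0, Serre witness** («`Ш(E/ℚ)[p^∞] = 0`»): from the row certificate `checkK ∧ k ≤ 0 ∧
2 ≤ rank` and GIVEN `hS` (PRS), the newform, Kato's divisibility for every cyclotomic datum, the L-datum
(`hLp`, `hcoeff : ord_p [T²]L_p = R.a`) and THE canonical height datum (`hreg : ord_p Reg_p = R.b`):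
`rank_ℤ E(ℚ) = 2`, `Ш(E/ℚ)[p^∞]` finite, `Reg_p ≠ 0`, `#Ш(E/ℚ)[p^∞] = 1`. Per pair; NOT a class theorem.
[cite: Kato2004Asterisque, Thm. 17.4 (3) (p. 273)] [cite: Serre1972, §2.8 Prop. 19]
[cite: SteinWuthrich2013, Alg. 11.1 and Prop. 11.2] -/
theorem booked_katoOne (h : R.checkK = true ∧ R.k ≤ 0 ∧ 2 ≤ (R.e.baseChange ℚ).mordellWeilRank) :
    haveI : Fact R.p.Prime := ⟨prime_of_check (check_of_checkK h.1)⟩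
    haveI := isElliptic (check_of_checkK h.1)
    haveI := isGloballyMinimal (check_of_checkK h.1)
    ∀ (_hS : Schneider1985_order_charGenerator_odd) {N : ℕ} [NeZero N] {f : CuspForm (Gamma0 N) 2}
      (_hf : IsNewformOf (R.e.baseChange ℚ) f)
      (_hK : ∀ (κ : ZpExtension ℚ R.p) (γ : Field.absoluteGaloisGroup ℚ),
        kato_divisibility (R.e.baseChange ℚ) R.p (κ := κ) (γ := γ) (f := f))
      (_hLp : PowerSeries.coeff 2 (padicLFunction f (unitRoot (R.e.baseChange ℚ) R.p : ℚ_[R.p])) ≠ 0)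
      (_hcoeff : (PowerSeries.coeff 2
        (padicLFunction f (unitRoot (R.e.baseChange ℚ) R.p : ℚ_[R.p]))).valuation = R.a)
      (Dh : PAdicHeightData (R.e.baseChange ℚ) R.p) (_hDh : Dh.IsCanonical)
      (_hreg : (padicRegulator Dh).valuation = R.b),
      (R.e.baseChange ℚ).mordellWeilRank = 2 ∧
        Finite (AddCommGroup.primaryComponent (R.e.baseChange ℚ).sha R.p) ∧ SchneiderConjecture Dh ∧
        Nat.card (AddCommGroup.primaryComponent (R.e.baseChange ℚ).sha R.p) = 1 := by
  intro hS N _ f hf hK hLp hcoeff Dh hDh hreg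
  haveI : Fact R.p.Prime := ⟨prime_of_check (check_of_checkK h.1)⟩
  haveI := isElliptic (check_of_checkK h.1)
  haveI := isGloballyMinimal (check_of_checkK h.1)
  exact kato_eq_one (check_of_checkK h.1) hS hf hK (surj_of_checkK h.1) h.2.2 hLp hcoeff Dh hDh hreg h.2.1

/-- **READER, V-BOUND 0, (irr)+(ram) witness** (cell ruling P-3a; `ρ̄` onto by `surj_of_irr_of_ram`): as
`booked_katoOne` from the certificate `checkSU ∧ k ≤ 0 ∧ 2 ≤ rank`. [cite: Kato2004Asterisque, Thm. 17.4 (3) (p. 273)]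
[cite: Serre1972, §5.2 (iii)] [cite: SteinWuthrich2013, Alg. 11.1 and Prop. 11.2] -/
theorem booked_katoOneSU (h : R.checkSU = true ∧ R.k ≤ 0 ∧ 2 ≤ (R.e.baseChange ℚ).mordellWeilRank) :
    haveI : Fact R.p.Prime := ⟨prime_of_check (check_of_checkSU h.1)⟩
    haveI := isElliptic (check_of_checkSU h.1)
    haveI := isGloballyMinimal (check_of_checkSU h.1)
    ∀ (_hS : Schneider1985_order_charGenerator_odd) {N : ℕ} [NeZero N] {f : CuspForm (Gamma0 N) 2}
      (_hf : IsNewformOf (R.e.baseChange ℚ) f)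
      (_hK : ∀ (κ : ZpExtension ℚ R.p) (γ : Field.absoluteGaloisGroup ℚ),
        kato_divisibility (R.e.baseChange ℚ) R.p (κ := κ) (γ := γ) (f := f))
      (_hLp : PowerSeries.coeff 2 (padicLFunction f (unitRoot (R.e.baseChange ℚ) R.p : ℚ_[R.p])) ≠ 0)
      (_hcoeff : (PowerSeries.coeff 2
        (padicLFunction f (unitRoot (R.e.baseChange ℚ) R.p : ℚ_[R.p]))).valuation = R.a)
      (Dh : PAdicHeightData (R.e.baseChange ℚ) R.p) (_hDh : Dh.IsCanonical)
      (_hreg : (padicRegulator Dh).valuation = R.b),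
      (R.e.baseChange ℚ).mordellWeilRank = 2 ∧
        Finite (AddCommGroup.primaryComponent (R.e.baseChange ℚ).sha R.p) ∧ SchneiderConjecture Dh ∧
        Nat.card (AddCommGroup.primaryComponent (R.e.baseChange ℚ).sha R.p) = 1 := by
  intro hS N _ f hf hK hLp hcoeff Dh hDh hreg
  haveI : Fact R.p.Prime := ⟨prime_of_check (check_of_checkSU h.1)⟩
  haveI := isElliptic (check_of_checkSU h.1)
  haveI := isGloballyMinimal (check_of_checkSU h.1)
  exact kato_eq_one (check_of_checkSU h.1) hS hf hK (surj_of_checkSU h.1) h.2.2 hLp hcoeff Dh hDh hreg h.2.1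

/-- **READER, V-BOUND `b`, Serre witness**: from `checkK ∧ 2 ≤ rank`: `rank = 2`, `Ш(E/ℚ)[p^∞]` finite,
`Reg_p ≠ 0`, `ord_p #Ш(E/ℚ)[p^∞] ≤ R.k`. [cite: Kato2004Asterisque, Thm. 17.4 (3) (p. 273)]
[cite: Serre1972, §2.8 Prop. 19] [cite: SteinWuthrich2013, Alg. 11.1 and Prop. 11.2] -/
theorem booked_katoLe (h : R.checkK = true ∧ 2 ≤ (R.e.baseChange ℚ).mordellWeilRank) :
    haveI : Fact R.p.Prime := ⟨prime_of_check (check_of_checkK h.1)⟩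
    haveI := isElliptic (check_of_checkK h.1)
    haveI := isGloballyMinimal (check_of_checkK h.1)
    ∀ (_hS : Schneider1985_order_charGenerator_odd) {N : ℕ} [NeZero N] {f : CuspForm (Gamma0 N) 2}
      (_hf : IsNewformOf (R.e.baseChange ℚ) f)
      (_hK : ∀ (κ : ZpExtension ℚ R.p) (γ : Field.absoluteGaloisGroup ℚ),
        kato_divisibility (R.e.baseChange ℚ) R.p (κ := κ) (γ := γ) (f := f))
      (_hLp : PowerSeries.coeff 2 (padicLFunction f (unitRoot (R.e.baseChange ℚ) R.p : ℚ_[R.p])) ≠ 0)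
      (_hcoeff : (PowerSeries.coeff 2
        (padicLFunction f (unitRoot (R.e.baseChange ℚ) R.p : ℚ_[R.p]))).valuation = R.a)
      (Dh : PAdicHeightData (R.e.baseChange ℚ) R.p) (_hDh : Dh.IsCanonical)
      (_hreg : (padicRegulator Dh).valuation = R.b),
      (R.e.baseChange ℚ).mordellWeilRank = 2 ∧
        Finite (AddCommGroup.primaryComponent (R.e.baseChange ℚ).sha R.p) ∧ SchneiderConjecture Dh ∧
        (padicValNat R.p (Nat.card (AddCommGroup.primaryComponent (R.e.baseChange ℚ).sha R.p)) : ℤ) ≤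
          R.k := by
  intro hS N _ f hf hK hLp hcoeff Dh hDh hreg
  haveI : Fact R.p.Prime := ⟨prime_of_check (check_of_checkK h.1)⟩
  haveI := isElliptic (check_of_checkK h.1)
  haveI := isGloballyMinimal (check_of_checkK h.1)
  exact kato (check_of_checkK h.1) hS hf hK (surj_of_checkK h.1) h.2 hLp hcoeff Dh hDh hreg

/-- **READER, V-BOUND `b`, (irr)+(ram) witness**: from `checkSU ∧ 2 ≤ rank`: `ord_p #Ш(E/ℚ)[p^∞] ≤ R.k`.
[cite: Kato2004Asterisque, Thm. 17.4 (3) (p. 273)] [cite: Serre1972, §5.2 (iii)]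
[cite: SteinWuthrich2013, Alg. 11.1 and Prop. 11.2] -/
theorem booked_katoLeSU (h : R.checkSU = true ∧ 2 ≤ (R.e.baseChange ℚ).mordellWeilRank) :
    haveI : Fact R.p.Prime := ⟨prime_of_check (check_of_checkSU h.1)⟩
    haveI := isElliptic (check_of_checkSU h.1)
    haveI := isGloballyMinimal (check_of_checkSU h.1)
    ∀ (_hS : Schneider1985_order_charGenerator_odd) {N : ℕ} [NeZero N] {f : CuspForm (Gamma0 N) 2}
      (_hf : IsNewformOf (R.e.baseChange ℚ) f)
      (_hK : ∀ (κ : ZpExtension ℚ R.p) (γ : Field.absoluteGaloisGroup ℚ),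
        kato_divisibility (R.e.baseChange ℚ) R.p (κ := κ) (γ := γ) (f := f))
      (_hLp : PowerSeries.coeff 2 (padicLFunction f (unitRoot (R.e.baseChange ℚ) R.p : ℚ_[R.p])) ≠ 0)
      (_hcoeff : (PowerSeries.coeff 2
        (padicLFunction f (unitRoot (R.e.baseChange ℚ) R.p : ℚ_[R.p]))).valuation = R.a)
      (Dh : PAdicHeightData (R.e.baseChange ℚ) R.p) (_hDh : Dh.IsCanonical)
      (_hreg : (padicRegulator Dh).valuation = R.b),
      (R.e.baseChange ℚ).mordellWeilRank = 2 ∧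
        Finite (AddCommGroup.primaryComponent (R.e.baseChange ℚ).sha R.p) ∧ SchneiderConjecture Dh ∧
        (padicValNat R.p (Nat.card (AddCommGroup.primaryComponent (R.e.baseChange ℚ).sha R.p)) : ℤ) ≤
          R.k := by
  intro hS N _ f hf hK hLp hcoeff Dh hDh hreg
  haveI : Fact R.p.Prime := ⟨prime_of_check (check_of_checkSU h.1)⟩
  haveI := isElliptic (check_of_checkSU h.1)
  haveI := isGloballyMinimal (check_of_checkSU h.1)
  exact kato (check_of_checkSU h.1) hS hf hK (surj_of_checkSU h.1) h.2 hLp hcoeff Dh hDh hreg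

/-- **READER, V-EXACT** (Skinner–Urban frame): from `checkSU ∧ 2 ≤ rank` and `hSU` for every cyclotomic datum:
`rank = 2`, `Ш(E/ℚ)[p^∞]` finite, `Reg_p ≠ 0`, `#Ш(E/ℚ)[p^∞] = p^k` with `k = R.k`.
[cite: SkinnerUrban2014, Thm. 3.6.9 (p. 45)] [cite: BalakrishnanMullerStein2015, Thm. 1.7]
[cite: SteinWuthrich2013, Alg. 11.1] -/
theorem booked_su (h : R.checkSU = true ∧ 2 ≤ (R.e.baseChange ℚ).mordellWeilRank) :
    haveI : Fact R.p.Prime := ⟨prime_of_check (check_of_checkSU h.1)⟩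
    haveI := isElliptic (check_of_checkSU h.1)
    haveI := isGloballyMinimal (check_of_checkSU h.1)
    ∀ (_hS : Schneider1985_order_charGenerator_odd) {N : ℕ} [NeZero N] {f : CuspForm (Gamma0 N) 2}
      (_hf : IsNewformOf (R.e.baseChange ℚ) f)
      (_hSU : ∀ (κ : ZpExtension ℚ R.p) (γ : Field.absoluteGaloisGroup ℚ),
        skinner_urban_main_conjecture (R.e.baseChange ℚ) R.p (κ := κ) (γ := γ) (f := f))
      (_hLp : PowerSeries.coeff 2 (padicLFunction f (unitRoot (R.e.baseChange ℚ) R.p : ℚ_[R.p])) ≠ 0)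
      (_hcoeff : (PowerSeries.coeff 2
        (padicLFunction f (unitRoot (R.e.baseChange ℚ) R.p : ℚ_[R.p]))).valuation = R.a)
      (Dh : PAdicHeightData (R.e.baseChange ℚ) R.p) (_hDh : Dh.IsCanonical)
      (_hreg : (padicRegulator Dh).valuation = R.b),
      (R.e.baseChange ℚ).mordellWeilRank = 2 ∧
        Finite (AddCommGroup.primaryComponent (R.e.baseChange ℚ).sha R.p) ∧ SchneiderConjecture Dh ∧
        ∃ k : ℕ, Nat.card (AddCommGroup.primaryComponent (R.e.baseChange ℚ).sha R.p) = R.p ^ k ∧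
          (k : ℤ) = R.k := by
  intro hS N _ f hf hSU hLp hcoeff Dh hDh hreg
  haveI : Fact R.p.Prime := ⟨prime_of_check (check_of_checkSU h.1)⟩
  haveI := isElliptic (check_of_checkSU h.1)
  haveI := isGloballyMinimal (check_of_checkSU h.1)
  exact su h.1 hS hf hSU h.2 hLp hcoeff Dh hDh hreg

/-- **READER, V-FINITE** (no image hypothesis, no `a`, `b`): from `check ∧ 2 ≤ rank`, GIVEN `hS`, the newform,
Kato's Thm. 17.4 for every cyclotomic datum and `[T²] L_p ≠ 0`: `rank_ℤ E(ℚ) = 2`, `ord_{T=0} L_p = 2`,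
`Ш(E/ℚ)[p^∞]` finite, every canonical `p`-adic height non-degenerate (observatory `padicRow_of_certificate`).
[cite: Kato2004Asterisque, Thm. 17.4 (p. 273)] [cite: BalakrishnanMullerStein2015, Thm. 1.7]
[cite: SteinWuthrich2013, Thm. 6.1 and §8] -/
theorem booked_finite (h : R.check = true ∧ 2 ≤ (R.e.baseChange ℚ).mordellWeilRank) :
    haveI : Fact R.p.Prime := ⟨prime_of_check h.1⟩
    haveI := isElliptic h.1
    haveI := isGloballyMinimal h.1
    ∀ (_hS : Schneider1985_order_charGenerator_odd) {N : ℕ} [NeZero N] {f : CuspForm (Gamma0 N) 2}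
      (_hf : IsNewformOf (R.e.baseChange ℚ) f)
      (_hK : ∀ (κ : ZpExtension ℚ R.p) (γ : Field.absoluteGaloisGroup ℚ),
        kato_divisibility (R.e.baseChange ℚ) R.p (κ := κ) (γ := γ) (f := f))
      (_hLp : PowerSeries.coeff 2 (padicLFunction f (unitRoot (R.e.baseChange ℚ) R.p : ℚ_[R.p])) ≠ 0),
      (R.e.baseChange ℚ).mordellWeilRank = 2 ∧
        (padicLFunction f (unitRoot (R.e.baseChange ℚ) R.p : ℚ_[R.p])).order = 2 ∧
        Finite (AddCommGroup.primaryComponent (R.e.baseChange ℚ).sha R.p) ∧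
        ∀ Dh : PAdicHeightData (R.e.baseChange ℚ) R.p, Dh.IsCanonical → SchneiderConjecture Dh := by
  intro hS N _ f hf hK hLp
  haveI : Fact R.p.Prime := ⟨prime_of_check h.1⟩
  haveI := isElliptic h.1
  haveI := isGloballyMinimal h.1
  exact padicRow_of_certificate (Schneider1985_order_charGenerator.of_odd hS) (R.e.baseChange ℚ) R.p hK
    (five_le_of_check h.1) (isOrdinaryAt_of_check h.1) hf h.2 hLp

end ShaRow

end Summit.BirchSwinnertonDyer.BirchSwinnertonDyer.Rank2Sha

end
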